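import Summits.ValiantsHypothesis.ValiantsHypothesis.Theorems.KPlusLogSqLawTropicalBThreeFiveRowD

/-!
# Route «KPlusLogSqLaw», crux `TropicalB` (stmt-ValiantsHypothesis-19771) — `(3,5)` row, the DEGENERATE exponent vectors:
# with a repeated exponent an unsigned dominant chain has at most `19` breakpoints

HONEST FRAMING.  Helper toward the registered stubs `stub_tropThin` / `stub_tropFat` of `Cruxes/TropicalB/Lines/birth.lean` (crux `TropicalB`,
item stmt-ValiantsHypothesis-19771; cell `pub-symmetroid`, seat val-sym-trop-p3 g10, 2026-08-28; `--supports … --as helper`).  A small census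
lemma for the format `(3,5)`: the ROOT CASE «`d` not injective» of the kernel programme «`TropRowD 3 5 31`» (memo HOME/val-sym-trop-p3/g10/
PROGRAMME-T35-exact.md), where the generic case is a decision tree of leaves shaped like `…ThreeFiveCellA`.  Nothing here bears on `TropicalB` in its
window, `WeakLifting`, DoorA26 / DoorA34, `MatrixDescartes` (stmt-ValiantsHypothesis-18050) or VP ≠ VNP.

THEOREM `designRowD_le_19_of_eq` : if two classes `a ≠ b` carry the same exponent, every unsigned dominant chain of every `(3,5)` design with these
exponents has at most `19` breakpoints (so certainly `≤ 31`).  PROOF: slopes strictly increase along the chain (`slope_strictMono_of_chainD`) and the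
slope of a term only depends on its class multiset with `b` replaced by `a`; these collapsed multisets avoid `b`, and there are `C(6,3) = 20` such
multisets (`decide`), so the chain has at most `20` terms.  `designRowD_le_31_of_not_injective` is the root-case packaging.  [this cell]
-/

set_option linter.dupNamespace false
set_option autoImplicit false

namespace Summit.ValiantsHypothesis.ValiantsHypothesis.Theorems.KPlusLogSqLaw

open Summit.ValiantsHypothesis.ValiantsHypothesis.Theorems.MatrixDescartes.Negative
open Summit.ValiantsHypothesis.ValiantsHypothesis.Theorems.LacunarySymmetroidMatrixDescartes.TropicalCensus
open Finset ForbiddenPatterns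

namespace ThreeFive

/-- the class multisets avoiding a given class number `20 = C(6,3)`. -/
theorem card_sym_avoid (b : Fin 5) : (univ.filter fun s : Sym (Fin 5) 3 => b ∉ s).card = 20 := by
  revert b
  decide +kernel

/-- **Repeated exponent ⇒ at most `19` breakpoints.**  If `d a = d b` for classes `a ≠ b`, every unsigned dominant chain of a `(3,5)` design with
exponents `d` has `n ≤ 19`. [this cell] -/
theorem designRowD_le_19_of_eq (d : Fin 5 → ℕ) {a b : Fin 5} (hab : a ≠ b) (hd : d a = d b)
    (v ε : Fin 3 → Fin 3 → Fin 5 → ℤ) : DesignRowD d v ε 19 := by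
  classical
  intro n θ p hθ hdom hne
  have hsm := slope_strictMono_of_chainD d v ε θ p hθ hdom hne
  -- collapse `b` onto `a`
  let f : Fin 5 → Fin 5 := fun c => if c = b then a else c
  have hf : ∀ c, d (f c) = d c := by
    intro c
    by_cases h : c = b
    · simp only [f, h, if_true, hd]
    · simp only [f, h, if_false]
  have hfb : ∀ c, f c ≠ b := by
    intro c
    by_cases h : c = b
    · simp only [f, h, if_true]; exact hab
    · simp only [f, h, if_false]; exact h
  let g : Fin (n + 1) → Sym (Fin 5) 3 := fun k => (classSym (p k)).map f
  have hslope : ∀ k, slope d (p k) = (((g k : Sym (Fin 5) 3) : Multiset (Fin 5)).map fun l => (d l : ℤ)).sum := by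
    intro k
    rw [slope_eq_of_classSym]
    simp only [g, Sym.coe_map, Multiset.map_map, Function.comp_def, hf]
  have hinj : Function.Injective g := by
    intro k k' h
    apply hsm.injective
    show slope d (p k) = slope d (p k')
    rw [hslope, hslope, h]
  have hrange : ∀ k ∈ (univ : Finset (Fin (n + 1))), g k ∈ (univ.filter fun s : Sym (Fin 5) 3 => b ∉ s) := by
    intro k _
    simp only [mem_filter, mem_univ, true_and, g, Sym.mem_map, not_exists, not_and]
    exact fun c _ => hfb c
  have hle := card_le_card_of_injOn g hrange (hinj.injOn)
  rw [card_univ, Fintype.card_fin, card_sym_avoid] at hle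
  omega

/-- **Root case of the programme «`TropRowD 3 5 31`»**: for a NON-injective exponent vector every unsigned dominant chain of a `(3,5)` design has
`n ≤ 31` (indeed `≤ 19`). [this cell] -/
theorem designRowD_le_31_of_not_injective (d : Fin 5 → ℕ) (hd : ¬ Function.Injective d)
    (v ε : Fin 3 → Fin 3 → Fin 5 → ℤ) : DesignRowD d v ε 31 := by
  have h' : ∃ a b, d a = d b ∧ a ≠ b := by
    by_contra hcon
    push Not at hcon
    exact hd fun a b hab => hcon a b hab
  obtain ⟨a, b, hab, hne⟩ := h'
  exact designRowD_mono (by norm_num) (designRowD_le_19_of_eq d hne hab v ε)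

end ThreeFive

end Summit.ValiantsHypothesis.ValiantsHypothesis.Theorems.KPlusLogSqLaw
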